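/-
Copyright (c) 2026 the pub-hodgecm-mathlib formalisation cell (harness21).  Prover seat hodgecm-mathlib-K2Liu-p07 (g3), Track B «K2-LIT»,
#184♮ = hLiu418 = `stmt-HodgeConjecture-24832`; #42S payer road, organ S1 (local Siegel–Weil spanning), ROAD W, file F5′-B (LEAD F0P6-plan (g14)
RULING «M-158a» (4) + BATCH #2 10:50:47Z (Q3): the SIMILITUDE TRANSPORT currency, Kudla rigidity layer).
-/
import Literature.NumberTheory.GelbartRogawski1991.LocalSplittingCMRationalSimilitudeRigidity   -- ★ P3c: the template + `map_deltaLagrangian_inv_of_map_eq`, rigidity capital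
import HarnessLib

/-!
# Crux `HLiu418`, #42S organ S1, ROAD W, file F5′-B: KUDLA RIGIDITY UNDER A `P_Δ`-PRESERVING AUTOMORPHISM REALISED SYMPLECTICALLY —
# `P̃⁻¹ · Σ_χ(θ g) · P̃ = scaleTransport_{m₀}(Σ′_χ)(g)` for the doubled CM Weil data of `T₀` and `T₀′ = m₀ T₀`

Cell `hodgecm-mathlib`, crux item hLiu418 = `stmt-HodgeConjecture-24832`; squad K2 ∕ K2Liu; LEAD F0P6-plan (g14), organ lead K2Liu-p06 (g4); prover
K2Liu-p07 (g3).  THEOREMS ONLY (no `def`, no instance, no notation, no named-fact hypothesis, no `sorry`); lane `--supports stmt-HodgeConjecture-24832 --as helper`.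

WHY.  Ruling «M-158a» (4) makes the SIMILITUDE TRANSPORT `R₂(V⁻_v) = D_a R₂(V⁺_v)` (`V⁻ ≅ (V⁺, a·h)`, `D_a f = f ∘ Ad(d_a)`, `d_a = (1 on Δ, a on ∇)`) the currency of
every `V⁻`-side statement of organ S1; for the Kudla–CM data OF RECORD this needs the identification of the doubled CM Weil section of `a·T₀` (read in the
`(T₀, δ∕a)`-model by ★ `scaleTransportSection`) with the `Ad(d_a)`-conjugate of the section of `T₀`.  The tree's ★ P3c
`localSplittingDatumCM_localCongr_kd_eq_scaleTransportSection` proves exactly this for the block-diagonal rational similitude `KD = k ⊕ k`; its proof uses `KD`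
only through FIVE facts.  This file re-runs that proof ONCE with the five facts as HYPOTHESES on an abstract endomorphism `θ` of `H(L⁺_v)` and a symplectic
`P` (so that `θ = Ad(d_a)` — files F5′-A1∕A2 `K2LiuLocalSWSimilitudeAlgebra`∕`…Symplectic` supply the facts — and the local isometries of the (S4-nat) frame
naturality (K2Liu-p01 (g7)) are both instances; LEAD BATCH #2: «one clone of one lemma»):
* (h1) `P · ι^𝔻_{δ∕m₀}(g) · P⁻¹ = ι^𝔻_δ(θ g)` for all `g`;  (h2) `P ℓ_Δ = ℓ_Δ`;  (h3) `θ P_Δ ⊆ P_Δ`;  (h4) `χ_v(det_Δ(θ p)) = χ_v(det_Δ p)` and (h5) `‖det_Δ(θ p)_w‖ = ‖det_Δ p_w‖`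
  on `P_Δ`.
* **`localSplittingDatumCM_comp_eq_scaleTransportSection`**: then `P̃⁻¹ · Σ_χ(θ g) · P̃ = scaleTransport_{m₀}(Σ′_χ)(g)` for every lift `P̃` of `P`, `T₀ = diag t` (`0 < n`)
  — both sides are sections over `ι^𝔻_{δ∕m₀}` (h1) with Kudla's parabolic normalisation and the same scalar `χ_v(det_Δ p)⁻¹ ∏_w ‖det_Δ p_w‖^{1∕2}` (★
  `parabolic_toRep_conj_scaleTransport_localSplittingDatumCM`; ★ `parabolic_toRep_conj_localSplittingDatumCM` at `θ p ∈ P_Δ` (h3) with (h4)(h5), moved through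
  `P̃⁻¹` by ★ `parabolic_toRep_conj_conj` since `P⁻¹ ℓ_Δ = ℓ_Δ` (h2)), and characters of `H(L⁺_v)` trivial on `P_Δ` are trivial (★ `eq_one_of_forall_isSiegelDelta_eq_one'`),
  so ★ `eq_of_parabolic_toRep_conj_eq` identifies them.  NO character is left over, NO Weil-index value enters.
References: [Kudla1994] §3 Thm. 3.1; [HarrisKudlaSweet1996] §1 (1.11)–(1.16); [GelbartRogawski1991] §3.1 Prop. 3.1.1 p. 455, Remark p. 457 L4–13;
[MoeglinVignerasWaldspurger1987] Chap. 2 II.1, Chap. 3 I.1–I.3.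
HONEST LABEL.  Count-neutral helper: `HC_CM` is proved only modulo the 7 printed citations (2 remaining named inputs: hLiu418 = `stmt-HodgeConjecture-24832`,
h413 = `stmt-HodgeConjecture-24833`) until rung 0 closes.
-/

set_option autoImplicit false
set_option linter.dupNamespace false -- the mandated namespace repeats `HodgeConjecture.HodgeConjecture`

noncomputable section

open scoped Matrix
open NumberField IsDedekindDomain MeasureTheory Matrix
open Literature.RepresentationTheory.HeisenbergGroup
open Literature.NumberTheory.Automorphic Literature.NumberTheory.Automorphic.UnitaryGroup Literature.NumberTheory.Weil1964
open Literature.NumberTheory.GaloisRepresentations Literature.RepresentationTheory.HarrisKudlaSweet1996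
open Literature.NumberTheory.GelbartRogawski1991.UnitaryDualPair Literature.NumberTheory.GelbartRogawski1991.UnitaryDualPair.LocalSplitting

namespace Summit.HodgeConjecture.HodgeConjecture.Cruxes.HLiu418.K2LiuLocalSWSimilitudeRigidity

variable (L : Type) [Field L] [NumberField L] [IsCMField L] (v : HeightOneSpectrum (𝓞 (maximalRealSubfield L)))
  [MeasurableSpace (v.adicCompletion (maximalRealSubfield L))] [BorelSpace (v.adicCompletion (maximalRealSubfield L))]
  (μ : Measure (v.adicCompletion (maximalRealSubfield L))) [μ.IsAddHaarMeasure]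
  (n : ℕ) {T₀ T₀' : Matrix (Fin n) (Fin n) (maximalRealSubfield L)}

set_option synthInstance.maxHeartbeats 400000 in
set_option maxHeartbeats 4000000 in -- as ★ P3c: the doubled CM telescopes in the STATEMENT elaborate slowly; the proof is plumbing
/-- **KUDLA RIGIDITY UNDER A `P_Δ`-PRESERVING AUTOMORPHISM REALISED SYMPLECTICALLY (doubled level).**  For a diagonal invertible `T₀` (`0 < n`), `T₀′ = m₀ T₀`,
a splitting Hecke character `χ`, an endomorphism `θ` of `H(L⁺_v)`, a symplectic `P` with `P · ι^𝔻_{δ∕m₀}(g) · P⁻¹ = ι^𝔻_δ(θ g)` and `P ℓ_Δ = ℓ_Δ`, `θ` preserving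
`P_Δ`, `χ_v(det_Δ ·)` and `‖det_Δ ·‖` on `P_Δ`, any lift `P̃` of `P` and any mover `m` of `ℓ_Δ` onto `ℓ_Y`:
`P̃⁻¹ · Σ_χ(θ g) · P̃ = scaleTransportSection_{m₀}(Σ′_χ)(g)` for all `g ∈ H(L⁺_v)`.  (★ P3c is the case `θ = Ad(k ⊕ k)`; F5′ uses `θ = Ad(d_a)`.)
[cite: Kudla1994, §3 Thm 3.1] [cite: HarrisKudlaSweet1996, §1 (1.16)] [cite: GelbartRogawski1991, §3.1 Remark p. 457 L4–13]
[cite: MoeglinVignerasWaldspurger1987, Chap. 3 I.1–I.3] -/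
theorem localSplittingDatumCM_comp_eq_scaleTransportSection (hn : 0 < n)
    (t : Fin n → maximalRealSubfield L) (hT₀t : T₀ = Matrix.diagonal t) (hT₀ : T₀.IsSymm) (hT₀d : IsUnit T₀.det)
    (hT₀' : T₀'.IsSymm) (hT₀'d : IsUnit T₀'.det) (m₀ : (maximalRealSubfield L)ˣ) (hTT₀ : T₀' = (m₀ : maximalRealSubfield L) • T₀)
    (χ : HeckeCharacter L) (hχ : IsSplittingChar L 1 χ)
    (θ : UnitaryGroup.localPi L (IsCMField.complexConj L) (n + n) ((gramD (maximalRealSubfield L) n T₀).map (algebraMap (maximalRealSubfield L) L)) v →*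
      UnitaryGroup.localPi L (IsCMField.complexConj L) (n + n) ((gramD (maximalRealSubfield L) n T₀).map (algebraMap (maximalRealSubfield L) L)) v)
    (Psp : LocalSp (maximalRealSubfield L) (n + n) (gramD (maximalRealSubfield L) n T₀) v)
    (hconj : ∀ g, Psp * iota (maximalRealSubfield L) L (IsCMField.complexConj L) (n + n) (conj_lineDelta (complexConj_imagUnit L) m₀)
        (lineDelta_ne_zero (imagUnit_ne_zero L) m₀) (lineDelta_mul_self (imagUnit_mul_self L) m₀) (gramD (maximalRealSubfield L) n T₀)
        (gramD_isSymm (maximalRealSubfield L) n hT₀) rfl v g * Psp⁻¹ =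
      iota (maximalRealSubfield L) L (IsCMField.complexConj L) (n + n) (complexConj_imagUnit L) (imagUnit_ne_zero L) (imagUnit_mul_self L)
        (gramD (maximalRealSubfield L) n T₀) (gramD_isSymm (maximalRealSubfield L) n hT₀) rfl v (θ g))
    (hPΔ : (deltaLagrangian (maximalRealSubfield L) v n).map (toLin (maximalRealSubfield L) v Psp) = deltaLagrangian (maximalRealSubfield L) v n)
    (hθP : ∀ p, IsSiegelDelta (maximalRealSubfield L) L (IsCMField.complexConj L) (complexConj_imagUnit L) (imagUnit_ne_zero L) (imagUnit_mul_self L) v n hT₀ rfl p →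
      IsSiegelDelta (maximalRealSubfield L) L (IsCMField.complexConj L) (complexConj_imagUnit L) (imagUnit_ne_zero L) (imagUnit_mul_self L) v n hT₀ rfl (θ p))
    (hθχ : ∀ p, IsSiegelDelta (maximalRealSubfield L) L (IsCMField.complexConj L) (complexConj_imagUnit L) (imagUnit_ne_zero L) (imagUnit_mul_self L) v n hT₀ rfl p →
      chiDet (maximalRealSubfield L) L (IsCMField.complexConj L) v n (fun w' : PlacesOver L v => (χ.localComponent w'.1)⁻¹) (θ p) =
        chiDet (maximalRealSubfield L) L (IsCMField.complexConj L) v n (fun w' : PlacesOver L v => (χ.localComponent w'.1)⁻¹) p)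
    (hθn : ∀ p, IsSiegelDelta (maximalRealSubfield L) L (IsCMField.complexConj L) (complexConj_imagUnit L) (imagUnit_ne_zero L) (imagUnit_mul_self L) v n hT₀ rfl p →
      ∀ w' : PlacesOver L v, ‖detDelta (maximalRealSubfield L) L (IsCMField.complexConj L) v n w' (θ p)‖ =
        ‖detDelta (maximalRealSubfield L) L (IsCMField.complexConj L) v n w' p‖)
    (P : LocalMp (maximalRealSubfield L) (n + n) (gramD (maximalRealSubfield L) n T₀) v) (hP : MpPsi.proj _ P = Psp)
    (m : LocalMp (maximalRealSubfield L) (n + n) (gramD (maximalRealSubfield L) n T₀) v)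
    (hm : (deltaLagrangian (maximalRealSubfield L) v n).map (toLin (maximalRealSubfield L) v (MpPsi.proj _ m)) =
      lagrangianY (maximalRealSubfield L) (n + n) v)
    (g : UnitaryGroup.localPi L (IsCMField.complexConj L) (n + n) ((gramD (maximalRealSubfield L) n T₀).map (algebraMap (maximalRealSubfield L) L)) v) :
    P⁻¹ * (localSplittingDatumCM L v μ n hT₀ hT₀d rfl χ hχ).localSplitting (θ g) * P =
      scaleTransportSection (maximalRealSubfield L) L (IsCMField.complexConj L) (n + n) (complexConj_imagUnit L) (imagUnit_ne_zero L)
        (imagUnit_mul_self L) (gramD (maximalRealSubfield L) n T₀) (gramD (maximalRealSubfield L) n T₀')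
        (gramD_isSymm (maximalRealSubfield L) n hT₀) (gramD_isSymm (maximalRealSubfield L) n hT₀') m₀
        (gramD_of_eq_smul (maximalRealSubfield L) m₀ hTT₀) rfl rfl v
        (localSplittingDatumCM L v μ n hT₀' hT₀'d rfl χ hχ).localSplitting
        (localSplittingDatumCM L v μ n hT₀' hT₀'d rfl χ hχ).proj_localSplitting g := by
  -- the conjugated section as a homomorphism `S g := P⁻¹ Σ(θ g) P`
  let S : UnitaryGroup.localPi L (IsCMField.complexConj L) (n + n) ((gramD (maximalRealSubfield L) n T₀).map (algebraMap (maximalRealSubfield L) L)) v →*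
      LocalMp (maximalRealSubfield L) (n + n) (gramD (maximalRealSubfield L) n T₀) v :=
    MonoidHom.mk' (fun g => P⁻¹ * (localSplittingDatumCM L v μ n hT₀ hT₀d rfl χ hχ).localSplitting (θ g) * P)
      (fun g h => by simp only [map_mul, mul_assoc, mul_inv_cancel_left])
  have hS : ∀ g, S g = P⁻¹ * (localSplittingDatumCM L v μ n hT₀ hT₀d rfl χ hχ).localSplitting (θ g) * P := fun _ => rfl
  rw [← hS]
  have hcδ' := conj_lineDelta (complexConj_imagUnit L) m₀
  have hδ' := lineDelta_ne_zero (imagUnit_ne_zero L) m₀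
  have hd' := lineDelta_mul_self (imagUnit_mul_self L) m₀
  -- `π(P)` preserves `ℓ_Δ`, hence so does `π(P⁻¹)`
  have hPΔ₁ : (deltaLagrangian (maximalRealSubfield L) v n).map (toLin (maximalRealSubfield L) v (MpPsi.proj _ P)) =
      deltaLagrangian (maximalRealSubfield L) v n := hP ▸ hPΔ
  have hPΔ' : (deltaLagrangian (maximalRealSubfield L) v n).map (toLin (maximalRealSubfield L) v (MpPsi.proj _ P⁻¹)) =
      deltaLagrangian (maximalRealSubfield L) v n := by
    rw [map_inv]
    exact map_deltaLagrangian_inv_of_map_eq (maximalRealSubfield L) v n _ hPΔ₁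
  have hmain : S = scaleTransportSection (maximalRealSubfield L) L (IsCMField.complexConj L) (n + n) (complexConj_imagUnit L) (imagUnit_ne_zero L)
        (imagUnit_mul_self L) (gramD (maximalRealSubfield L) n T₀) (gramD (maximalRealSubfield L) n T₀')
        (gramD_isSymm (maximalRealSubfield L) n hT₀) (gramD_isSymm (maximalRealSubfield L) n hT₀') m₀
        (gramD_of_eq_smul (maximalRealSubfield L) m₀ hTT₀) rfl rfl v
        (localSplittingDatumCM L v μ n hT₀' hT₀'d rfl χ hχ).localSplitting
        (localSplittingDatumCM L v μ n hT₀' hT₀'d rfl χ hχ).proj_localSplitting := by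
    refine eq_of_parabolic_toRep_conj_eq (maximalRealSubfield L) L (IsCMField.complexConj L) hcδ' hδ' hd' v n hT₀ hT₀d rfl _ _ ?_ ?_
      (fun p => (((chiDet (maximalRealSubfield L) L (IsCMField.complexConj L) v n (fun w' : PlacesOver L v => (χ.localComponent w'.1)⁻¹) p)⁻¹ : ℂˣ) : ℂ) *
        ((∏ w' : PlacesOver L v, Real.sqrt ‖detDelta (maximalRealSubfield L) L (IsCMField.complexConj L) v n w' p‖ : ℝ) : ℂ)) ?_ m ?_ ?_
    · -- (i) equal projections: `π(P)⁻¹ ι_δ(θ g) π(P) = ι_{δ/m₀}(g)` from (h1)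
      intro g
      rw [hS, proj_scaleTransportSection, map_mul, map_mul, map_inv, hP, (localSplittingDatumCM L v μ n hT₀ hT₀d rfl χ hχ).proj_localSplitting, ← hconj g]
      simp only [mul_assoc, inv_mul_cancel, mul_one, inv_mul_cancel_left]
    · -- (iv) characters trivial on `P_Δ` are trivial
      exact fun θ' hθ' => eq_one_of_forall_isSiegelDelta_eq_one' (maximalRealSubfield L) L (IsCMField.complexConj L) hcδ' hδ' hd' v n hn t hT₀t hT₀ hT₀d rfl θ' hθ'
    · -- the scalar does not vanish on `P_Δ`
      intro p hp
      refine mul_ne_zero (Units.ne_zero _) ?_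
      rw [Complex.ofReal_ne_zero]
      refine Finset.prod_ne_zero_iff.2 fun w' _ => ?_
      rw [Real.sqrt_ne_zero (norm_nonneg _), norm_ne_zero_iff]
      exact detDelta_ne_zero (maximalRealSubfield L) L (IsCMField.complexConj L) hcδ' hδ' hd' v n hT₀ rfl hp w'
    · -- (iii-a) the scale-transported section is normalised with the scalar
      intro p hp Φ
      exact parabolic_toRep_conj_scaleTransport_localSplittingDatumCM L v μ n m₀ hT₀ hT₀' hT₀'d
        (gramD_of_eq_smul (maximalRealSubfield L) m₀ hTT₀) χ hχ m hm p hp Φ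
    · -- (iii-b) the conjugated section `P⁻¹ Σ(θ ·) P` is normalised with the same scalar (★ `parabolic_toRep_conj_conj` at `P⁻¹`)
      intro p hp Φ
      have hconj' := parabolic_toRep_conj_conj (maximalRealSubfield L) L (IsCMField.complexConj L) v n (complexConj_imagUnit L) (imagUnit_ne_zero L)
        (imagUnit_mul_self L) hcδ' hδ' hd' hT₀ rfl
        ((localSplittingDatumCM L v μ n hT₀ hT₀d rfl χ hχ).localSplitting.comp θ)
        (fun p => (((chiDet (maximalRealSubfield L) L (IsCMField.complexConj L) v n (fun w' : PlacesOver L v => (χ.localComponent w'.1)⁻¹) p)⁻¹ : ℂˣ) : ℂ) *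
          ((∏ w' : PlacesOver L v, Real.sqrt ‖detDelta (maximalRealSubfield L) L (IsCMField.complexConj L) v n w' p‖ : ℝ) : ℂ))
        ?_ P⁻¹ hPΔ' m hm p hp Φ
      · rw [inv_inv] at hconj'
        rw [hS]
        exact hconj'
      · -- the normalisation of `Σ ∘ θ` for every mover: `θ p ∈ P_Δ` (h3) with the same `det_Δ` data (h4)(h5)
        intro m' hm' p' hp' Φ'
        rw [MonoidHom.comp_apply, parabolic_toRep_conj_localSplittingDatumCM L v μ n hT₀ hT₀d rfl χ hχ m' hm' _ (hθP p' hp') Φ', hθχ p' hp']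
        congr 2
        push_cast
        exact Finset.prod_congr rfl fun w' _ => by rw [hθn p' hp' w']
  exact DFunLike.congr_fun hmain _

end Summit.HodgeConjecture.HodgeConjecture.Cruxes.HLiu418.K2LiuLocalSWSimilitudeRigidity

end
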